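import Mathlib
import Literature.AlgebraicGeometry.Resolution.AdicNoetherian
import Literature.AlgebraicGeometry.Resolution.NodalPowRingSingularLocus
import HarnessLib

/-!
# Route `PicardMuOrdinary`, crux `MuOrdinaryFamilyRT` (stmt-Langlands-13757), line
# `char-zero-dominance`: the weight algebra `𝒪⟦X₁, X₂, X₃⟧` has Krull dimension `≤ 4`

Side obligation (design note 4 of the line card) of STUB 2 `stub_charZeroFamily` (THE LEVER) of the
checked skeleton `Cruxes/MuOrdinaryFamilyRT/Lines/char-zero-dominance.lean` for the crux
`Summit.Langlands.Langlands.Theses.PicardMuOrdinary.MuOrdinaryFamilyRT` (item `stmt-Langlands-13757`).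
The intended witness of the structure `OrdFamily` carries the weight algebra
`Λ = 𝒪⟦X₁, X₂, X₃⟧ = MvPowerSeries (Fin 3) 𝒪` (one branch of the rank-`3` polarized ordinary weight
space of `U(3)`, `𝒪` the integers of a finite extension of `ℚ₃`, a discrete valuation ring), and the
field `OrdFamily.dim_le` asks for `ringKrullDim Λ ≤ 4`.  This file proves exactly that bound, as pure
commutative algebra:

**Statement.** For a discrete valuation ring `𝒪`, `ringKrullDim (MvPowerSeries (Fin 3) 𝒪) ≤ 4`.

**Proof.** `A = 𝒪⟦X₀, X₁, X₂⟧` is a Noetherian (tree: `isNoetherianRing_mvPowerSeries`, Stacks 0306)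
local ring.  Its maximal ideal is generated by the four elements `C ϖ, X₀, X₁, X₂`, `ϖ` a uniformizer
of `𝒪`: a power series is a non-unit iff its constant coefficient is a non-unit of `𝒪`
(Mathlib `MvPowerSeries.isUnit_iff_constantCoeff`), i.e. a multiple of `ϖ`, and a series with zero
constant coefficient lies in `(X₀, X₁, X₂)` (tree:
`MvPowerSeries.mem_span_X_image_of_coeff_eq_zero`).  By Krull's height theorem (Mathlib
`ringKrullDim_le_spanFinrank_maximalIdeal`) `dim A ≤ 4`.  (Equality `dim A = 4` also holds but is not
needed by `OrdFamily.dim_le`.)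

References: H. Matsumura, *Commutative Ring Theory*, CUP 1986, Thm. 3.3 (power series over a
Noetherian ring), Thm. 13.5 (Krull's height theorem), Thm. 15.4.
-/

-- `Summit.Langlands.Langlands.…` (summit = sub-problem name, D-0017 layout) trips `dupNamespace` on every decl.
set_option linter.dupNamespace false

namespace Summit.Langlands.Langlands.Cruxes.MuOrdinaryFamilyRT.CharZeroDominance

open IsLocalRing

/-- In `R⟦Xᵢ : i ∈ σ⟧` (`σ` finite) a power series with zero constant coefficient lies in the ideal
generated by the variables. [folklore] -/
theorem mem_span_range_X_of_constantCoeff_eq_zero {σ : Type*} [Fintype σ] {R : Type*} [CommRing R]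
    (f : MvPowerSeries σ R) (hf : MvPowerSeries.constantCoeff f = 0) :
    f ∈ Ideal.span (Set.range (MvPowerSeries.X : σ → MvPowerSeries σ R)) := by
  have h := Literature.AlgebraicGeometry.Resolution.MvPowerSeries.mem_span_X_image_of_coeff_eq_zero
    (Finset.univ : Finset σ) f (fun x hx => by
      have hx0 : x = 0 := Finsupp.ext fun c => hx c (Finset.mem_univ c)
      rw [hx0, MvPowerSeries.coeff_zero_eq_constantCoeff_apply, hf])
  simpa [Finset.coe_univ, Set.image_univ] using h

/-- Over a local ring `𝒪` with principal maximal ideal `(ϖ)`, the maximal ideal of `𝒪⟦Xᵢ : i ∈ σ⟧`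
(`σ` finite) is contained in — hence equal to — the ideal `(C ϖ, Xᵢ : i ∈ σ)`. [folklore] -/
theorem maximalIdeal_mvPowerSeries_le_span {σ : Type*} [Fintype σ] (𝒪 : Type*) [CommRing 𝒪]
    [IsLocalRing 𝒪] (ϖ : 𝒪) (hϖ : maximalIdeal 𝒪 = Ideal.span {ϖ}) :
    maximalIdeal (MvPowerSeries σ 𝒪) ≤
      Ideal.span (insert (MvPowerSeries.C ϖ)
        (Set.range (MvPowerSeries.X : σ → MvPowerSeries σ 𝒪))) := by
  intro f hf
  rw [mem_maximalIdeal, mem_nonunits_iff, MvPowerSeries.isUnit_iff_constantCoeff] at hf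
  have hc : MvPowerSeries.constantCoeff f ∈ maximalIdeal 𝒪 := hf
  rw [hϖ, Ideal.mem_span_singleton'] at hc
  obtain ⟨a, ha⟩ := hc
  have hsplit : f = MvPowerSeries.C a * MvPowerSeries.C ϖ +
      (f - MvPowerSeries.C (MvPowerSeries.constantCoeff f)) := by
    rw [← map_mul, ha]; ring
  rw [hsplit]
  refine Ideal.add_mem _ (Ideal.mul_mem_left _ _ (Ideal.subset_span (Set.mem_insert _ _))) ?_
  refine Ideal.span_mono (Set.subset_insert _ _)
    (mem_span_range_X_of_constantCoeff_eq_zero _ ?_)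
  rw [map_sub, MvPowerSeries.constantCoeff_C, sub_self]

-- The registered signature (verbatim below) carries `[IsDomain 𝒪] [IsDiscreteValuationRing 𝒪]`, exactly as
-- the fields of `OrdFamily`; Mathlib's `IsDiscreteValuationRing` REQUIRES the `IsDomain` argument, so the
-- `overlappingInstances` linter's suggestion to drop one of them cannot be followed: silence it here only.
set_option linter.overlappingInstances false in
/-- **The weight algebra `𝒪⟦X₁, X₂, X₃⟧` of the intended `OrdFamily` has Krull dimension `≤ 4`**
(the field `OrdFamily.dim_le` for `Λ = MvPowerSeries (Fin 3) 𝒪`, `𝒪` a discrete valuation ring):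
the maximal ideal of the Noetherian local ring `𝒪⟦X₀, X₁, X₂⟧` is generated by the four elements
`C ϖ, X₀, X₁, X₂` (`ϖ` a uniformizer), so Krull's height theorem bounds the dimension by `4`.
[cite: Matsumura1987, Thm. 13.5] -/
theorem ringKrullDim_mvPowerSeries_fin_three_le : ∀ (𝒪 : Type) [CommRing 𝒪] [IsDomain 𝒪] [IsDiscreteValuationRing 𝒪], ringKrullDim (MvPowerSeries (Fin 3) 𝒪) ≤ (4 : ℕ) := by
  intro 𝒪 _ _ _
  classical
  haveI : IsNoetherianRing (MvPowerSeries (Fin 3) 𝒪) :=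
    Literature.AlgebraicGeometry.Resolution.isNoetherianRing_mvPowerSeries (R := 𝒪) (Fin 3)
  obtain ⟨ϖ, hirr⟩ := IsDiscreteValuationRing.exists_irreducible 𝒪
  have hϖ : maximalIdeal 𝒪 = Ideal.span {ϖ} :=
    (IsDiscreteValuationRing.irreducible_iff_uniformizer ϖ).mp hirr
  set s : Finset (MvPowerSeries (Fin 3) 𝒪) := insert (MvPowerSeries.C ϖ)
    (Finset.univ.image (MvPowerSeries.X : Fin 3 → MvPowerSeries (Fin 3) 𝒪)) with hs_def
  have hcoe : (s : Set (MvPowerSeries (Fin 3) 𝒪)) = insert (MvPowerSeries.C ϖ)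
      (Set.range (MvPowerSeries.X : Fin 3 → MvPowerSeries (Fin 3) 𝒪)) := by
    simp [hs_def, Set.image_univ]
  have hle : maximalIdeal (MvPowerSeries (Fin 3) 𝒪) ≤ Ideal.span (s : Set _) := by
    rw [hcoe]
    exact maximalIdeal_mvPowerSeries_le_span 𝒪 ϖ hϖ
  have hge : Ideal.span (s : Set _) ≤ maximalIdeal (MvPowerSeries (Fin 3) 𝒪) := by
    rw [hcoe, Ideal.span_le]
    rintro g (rfl | ⟨i, rfl⟩)
    · rw [SetLike.mem_coe, mem_maximalIdeal, mem_nonunits_iff,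
        MvPowerSeries.isUnit_iff_constantCoeff, MvPowerSeries.constantCoeff_C]
      exact hirr.not_isUnit
    · rw [SetLike.mem_coe, mem_maximalIdeal, mem_nonunits_iff,
        MvPowerSeries.isUnit_iff_constantCoeff, MvPowerSeries.constantCoeff_X]
      exact not_isUnit_zero
  have heq : maximalIdeal (MvPowerSeries (Fin 3) 𝒪) = Ideal.span (s : Set _) := le_antisymm hle hge
  have hcard : s.card ≤ 4 := by
    calc s.card ≤ (Finset.univ.image (MvPowerSeries.X : Fin 3 → MvPowerSeries (Fin 3) 𝒪)).card + 1 :=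
          Finset.card_insert_le _ _
      _ ≤ (Finset.univ : Finset (Fin 3)).card + 1 := by gcongr; exact Finset.card_image_le
      _ = 4 := by simp
  have h1 := ringKrullDim_le_spanFinrank_maximalIdeal (MvPowerSeries (Fin 3) 𝒪)
  have h2 : (maximalIdeal (MvPowerSeries (Fin 3) 𝒪)).spanFinrank ≤ 4 := by
    rw [heq]
    calc (Ideal.span (s : Set (MvPowerSeries (Fin 3) 𝒪))).spanFinrank
        ≤ (s : Set (MvPowerSeries (Fin 3) 𝒪)).ncard :=
          Submodule.spanFinrank_span_le_ncard_of_finite s.finite_toSet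
      _ = s.card := Set.ncard_coe_finset s
      _ ≤ 4 := hcard
  calc ringKrullDim (MvPowerSeries (Fin 3) 𝒪)
      ≤ ((maximalIdeal (MvPowerSeries (Fin 3) 𝒪)).spanFinrank : WithBot ℕ∞) := h1
    _ ≤ ((4 : ℕ) : WithBot ℕ∞) := by exact_mod_cast h2

end Summit.Langlands.Langlands.Cruxes.MuOrdinaryFamilyRT.CharZeroDominance
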